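import Summits.BirchSwinnertonDyer.Rank1Residual.X12.O11.RouteUTraceForm
import Summits.BirchSwinnertonDyer.BirchSwinnertonDyer.Theorems.PrintCFramBottomClassIndexLawFiveLeAnchorReduction
import Summits.BirchSwinnertonDyer.BirchSwinnertonDyer.Theorems.PrintCFramBottomClassIndexLawFiveLeAnchorTraceForm163
import Summits.BirchSwinnertonDyer.Rank1Residual.P2.CMKolyvaginTamagawaIndexOddHeegnerBases
import HarnessLib

/-!
# Crux `PrintCFram.BottomClassIndexLawFiveLe` (stmt-BirchSwinnertonDyer-20372), line `katz-genus-crossing`, research stub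
# `stub_heegnerFieldPPart`: the EISENSTEIN TRACE FORM at the CM-ramified prime for the leaf curves at `p ≥ 11` —
# `a_ℓ(A(p)) ≡ ℓ^{(p+1)/4} + ℓ^{(3p−1)/4} (mod p)` for Gross's curves `A(11), A(19), A(43), A(67)`, PROVED in the kernel,
# through a GENERIC «Mazur 1978 in trace form» lemma (any `E/ℚ` reducible at `p` with good reduction away from `p`)
# (cell `bsd-print-cfram`, width seat `bsd-line-cfram-p1-w2` g2; THEOREMS ONLY, `--supports` 20372; BSD is not proved by any of this)

HONEST FRAMING. Nothing here is a statement about BSD. The research stub of the registered line is, in the kernel, `BSD(W, p)`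
for a CM member `W` at the prime `p` RAMIFIED in its CM field, attacked over a Heegner field `K''` in which `p` SPLITS
(`KatzGenusCrossing.pPartOverHeegnerField_iff_bsdp`). Every Eisenstein-prime method over such a `K''` — Kriz–Li 2019 Thm. 1.20
(cell `bsd-cm`'s Route U at `p = 7`, `RouteU.hss_of_traceForm`), and the Castella–Grossi–Lee–Skinner-type congruences between the
BDP `p`-adic `L`-function of `(W, K'')` and Katz `p`-adic `L`-functions of the two CHARACTERS of `W[p]^{ss}` over `K''` — consumes
one input about `W`: the semisimplified residual representation `W[p]^{ss} ≅ 𝔽_p(ψ) ⊕ 𝔽_p(ψ⁻¹ω)`, i.e. the trace form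
`a_ℓ(W) ≡ ψ(ℓ) + ψ⁻¹ω(ℓ) (mod p)`. This file PROVES that input, uniformly, for the five leaf classes at `p ≥ 11` (the two `p = 7`
classes are cell `bsd-cm`'s `RouteU.lFunction_cm7_mod_seven` / `lFunction_twist_cm7_mod_seven`; the bare `p = 163` curve is the
previous w2's `lFunction_cm163_mod`, p611699, re-used here):

* §0 (generic, any `E/ℚ`, any prime `p`) `exists_frobeniusTrace_mod_eq_pow_add` — **Mazur 1978 in trace form**: if `E[p]` is
  reducible and `E` has good reduction at every prime `≠ p`, there is `k < p − 1` with
  `a_q(E) ≡ qᵏ + q·q^{(p−2)k mod (p−1)} (mod p)` for EVERY prime `q ≠ p` (isogeny character of the stable line unramified outside `p`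
  ⟹ `= χ̄_pᵏ`, "`ℚ` n'admet pas d'extension non ramifiée"; Prop. 6.3 (1) `a_q ≡ r(φ_q) + q·r(φ_q)⁻¹`). The curve-specific parts of
  (E49)/p611699 factored out once.
* §1–§4 the four remaining Gross curves `A(11) = 121b1 = cm11`, `A(19) = 361a1 = cm19`, `A(43) = 1849a1 = cm43`, `A(67) = 4489a1 = cm67`:
  one kernel point count each (`a₂(cm11) = a₂(cm19) = a₂(cm67) = 0`, `a₃(cm43) = 0` — `2` resp. `3` is a primitive root mod `p` inert in
  `ℚ(√−p)`), one `(p−1)`-case kernel check pinning `k ∈ {(p+1)/4, (3p−1)/4}`, and the trace forms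
  `a_ℓ(cm11) ≡ ℓ³ + ℓ⁸ (mod 11)`, `a_ℓ(cm19) ≡ ℓ⁵ + ℓ¹⁴ (mod 19)`, `a_ℓ(cm43) ≡ ℓ¹¹ + ℓ³² (mod 43)`, `a_ℓ(cm67) ≡ ℓ¹⁷ + ℓ⁵⁰ (mod 67)`
  for every prime `ℓ ≠ p` (Gross, LNM 776, Thm. 13.1.2 `A(p)[𝔭] ≅ μ_p^{⊗(3p−1)/4}` in trace form; Buhler–Gross 1985 (4.3)).
  The odd-Heegner twists `A(p)^{(D)}` (any model; `a_ℓ ≡ (ℓ/|D|)(ℓ^{(p+1)/4} + ℓ^{(3p−1)/4})`) are in the companion file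
  `…EisensteinTraceFormTwist.lean`.

Why the exponents are `(p+1)/4`, `(3p−1)/4` for every member (for the record; the kernel proofs pin them by point counts):
`W[𝔭] = ker √−p` is a `Γ_ℚ`-line with character `χ`; `√−p` induces `W[p]/W[𝔭] ≅ W[𝔭] ⊗ ε` (`ε = χ_{−p} = ω^{(p−1)/2}`), so the
quotient character is `χε`; `det = ω` gives `χ² = ω^{(p+1)/2}`, `χ ∈ {ω^{(p+1)/4}, ω^{(3p−1)/4}}·η` with `η² = 1`.
beyond-print theorem: NO (Gross 1980 Thm. 13.1.2 / Buhler–Gross 1985 (4.3), re-proved in the kernel).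

References: [Mazur1978] §5 (p. 148), Prop. 6.3 (1) (p. 153); [Gross1980] Thm. 13.1.2; [BuhlerGross1985] Ch. I (4.3);
[KrizLi2019] Thm. 1.20, §2; [Cremona1997] Table 1 (121b1, 361a1, 1849a1, 4489a1); [SilvermanATAEC1994] App. A §3;
[SilvermanAEC2009] X.2 Exercise 10.16 (twisting).
-/

noncomputable section

-- summit-side namespace `Summit.BirchSwinnertonDyer.BirchSwinnertonDyer.…` (single-conjunct summit, D-0017 layout)
set_option linter.dupNamespace false

open scoped Classical
open NumberField IsDedekindDomain IsDedekindDomain.HeightOneSpectrum Field WeierstrassCurve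
open Literature.NumberTheory.EllipticCurves Literature.NumberTheory.GaloisRepresentations
open Literature.NumberTheory.EllipticCurves.Rank1Residual
open Summit.BirchSwinnertonDyer.Rank1Residual

namespace Summit.BirchSwinnertonDyer.BirchSwinnertonDyer.Theorems.PrintCFram.EisensteinTraceForm

/-! ## §0 Generic: Mazur 1978 in trace form for a curve reducible at `p` with good reduction away from `p` -/

/-- In `𝔽_p`: `y⁻¹ = y^{p−2}` for `y ≠ 0`. [folklore] -/
theorem inv_eq_pow_sub_two {p : ℕ} [hp : Fact p.Prime] {y : ZMod p} (hy : y ≠ 0) : y⁻¹ = y ^ (p - 2) := by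
  have h : y ^ (p - 1) = 1 := ZMod.pow_card_sub_one_eq_one hy
  have h2 : 2 ≤ p := hp.out.two_le
  refine inv_eq_of_mul_eq_one_right ?_
  rw [← pow_succ', show p - 2 + 1 = p - 1 by omega, h]

/-- A prime `q ≠ p` is a unit mod `p`: `q^{p−1} = 1` in `𝔽_p`. [folklore] -/
theorem natCast_pow_sub_one_eq_one {p q : ℕ} [Fact p.Prime] (hq : q.Prime) (h : q ≠ p) :
    (q : ZMod p) ^ (p - 1) = 1 := by
  have hq0 : (q : ZMod p) ≠ 0 := by
    rw [Ne, ZMod.natCast_eq_zero_iff]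
    exact fun hd => h ((Nat.prime_dvd_prime_iff_eq Fact.out hq).mp hd).symm
  exact ZMod.pow_card_sub_one_eq_one hq0

/-- Good reduction at the finite places `v ∌ p` from good reduction at every prime `≠ p`. [folklore] -/
theorem hasGoodReductionAt_of_forall_ne (W : WeierstrassCurve ℚ) (p : ℕ)
    (hgood : ∀ (q : ℕ) [Fact q.Prime], q ≠ p → W.HasGoodReductionAtPrime q)
    {v : HeightOneSpectrum (𝓞 ℚ)} (hv : ((p : ℕ) : 𝓞 ℚ) ∉ v.asIdeal) : W.HasGoodReductionAt v := by
  haveI := Fact.mk (Rat.HeightOneSpectrum.primesEquiv v).2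
  have h : (Rat.HeightOneSpectrum.primesEquiv v : ℕ) ≠ p := by
    intro h
    apply hv
    rw [DeuringLadic.natCast_mem_asIdeal_iff, h]
  exact (hasGoodReductionAtPrime_iff_hasGoodReductionAt_ringOfIntegers v W).mp (hgood _ h)

/-- **Mazur 1978 in trace form (generic).** Let `E/ℚ` be a globally minimal elliptic curve, `p` a prime with `E[p]` REDUCIBLE,
and suppose `E` has good reduction at every prime `q ≠ p`. Then there is `k < p − 1` such that for EVERY prime `q ≠ p`
`a_q(E) ≡ qᵏ + q·q^{((p−2)k) mod (p−1)} (mod p)` (i.e. `a_q ≡ qᵏ + q^{1−k}`). Proof: a `Γ_ℚ`-stable line `⟨P⟩ ⊂ E[p]`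
(`Mazur1978.not_hasIrreducibleModPGaloisRep_iff_exists_natCard_eq`) with isogeny character `r` (`exists_isogenyCharacter`); `r` is
unramified outside `p` (good reduction, `isogenyCharacter_eq_one_of_mem_inertia`), hence `r = χ̄_pᵏ` ("`ℚ` has no unramified
abelian extension", `exists_forall_eq_mul_modNCyclotomicCharacter_pow` with `n = 1`); Prop. 6.3 (1)
(`isogenyCharacter_add_div_eq_frobeniusTrace`: `a_q ≡ r(φ_q) + q·r(φ_q)⁻¹`) with `χ̄_p(φ_q) = q`; finally `y⁻¹ = y^{p−2}` and
`q^{p−1} = 1` put it in polynomial form. [cite: Mazur1978, §5 (p. 148) and Prop. 6.3 (1) (p. 153)] -/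
theorem exists_frobeniusTrace_mod_eq_pow_add (W : WeierstrassCurve ℚ) [W.IsElliptic] [W.IsGloballyMinimal]
    (p : ℕ) [hp : Fact p.Prime] (hred : ¬ W.HasIrreducibleModPGaloisRep p)
    (hgood : ∀ (q : ℕ) [Fact q.Prime], q ≠ p → W.HasGoodReductionAtPrime q) :
    ∃ k : ℕ, k < p - 1 ∧ ∀ (q : ℕ) [Fact q.Prime], q ≠ p →
      (W.frobeniusTrace q : ZMod p) = (q : ZMod p) ^ k + (q : ZMod p) * (q : ZMod p) ^ ((p - 2) * k % (p - 1)) := by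
  haveI : NeZero ((p : ℕ) : ℚ) := ⟨by exact_mod_cast hp.out.ne_zero⟩
  obtain ⟨H, hH, hcard⟩ := (Mazur1978.not_hasIrreducibleModPGaloisRep_iff_exists_natCard_eq W p).mp hred
  obtain ⟨P, hP0, rfl⟩ := Mazur1978.exists_eq_zmultiples_of_natCard_eq W p hcard
  have hst : ∀ σ : absoluteGaloisGroup ℚ, σ • P ∈ AddSubgroup.zmultiples P :=
    fun σ => hH σ P (AddSubgroup.mem_zmultiples P)
  obtain ⟨r, hr⟩ := Mazur1978.exists_isogenyCharacter W p hP0 hst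
  -- `r` is unramified outside `p`, hence `r = χ̄_pᵏ`
  have hker := Mazur1978.isOpen_ker_of_smul_eq W p hP0 hr
  obtain ⟨k, -, hk⟩ := Mazur1978.exists_forall_eq_mul_modNCyclotomicCharacter_pow p r hker (n := 1)
    (fun v hv 𝔓 h𝔓 τ hτ => by
      rw [pow_one]
      exact Mazur1978.isogenyCharacter_eq_one_of_mem_inertia W p hP0 hr
        (hasGoodReductionAt_of_forall_ne W p hgood hv) hv h𝔓 hτ)
  have hk' : ∀ σ : absoluteGaloisGroup ℚ, r σ = modNCyclotomicCharacter ℚ p σ ^ k := fun σ => by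
    obtain ⟨b, hb, h⟩ := hk σ
    rw [pow_one] at hb
    rw [h, hb, one_mul]
  -- Mazur's Prop. 6.3 (1) at a good prime `q ≠ p`: `a_q ≡ qᵏ + q·(qᵏ)⁻¹`
  have key : ∀ (q : ℕ) [Fact q.Prime], q ≠ p →
      (W.frobeniusTrace q : ZMod p) = (q : ZMod p) ^ k + (q : ZMod p) * ((q : ZMod p) ^ k)⁻¹ := by
    intro q hq hqp
    set v : HeightOneSpectrum (𝓞 ℚ) := (Rat.HeightOneSpectrum.primesEquiv (R := 𝓞 ℚ)).symm ⟨q, hq.out⟩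
      with hvdef
    have hvq : (Rat.HeightOneSpectrum.primesEquiv v : ℕ) = q := by
      rw [hvdef, Equiv.apply_symm_apply]
    have hv : (q : 𝓞 ℚ) ∈ v.asIdeal := by
      rw [DeuringLadic.natCast_mem_asIdeal_iff, hvq]
    obtain ⟨𝔓, h𝔓⟩ := v.primesAbove_nonempty
    obtain ⟨φ, hφ⟩ := exists_isArithFrobAt_of_mem_primesAbove_holds (K := ℚ) (v := v) h𝔓
    have hq' : ¬ q ∣ p := fun hd => hqp ((Nat.prime_dvd_prime_iff_eq hq.out hp.out).mp hd)
    have hχ : (modNCyclotomicCharacter ℚ p φ : ZMod p) = q :=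
      Rat.modNCyclotomicCharacter_of_isArithFrobAt hq.out hq' hv h𝔓 hφ
    have hmaz := Mazur1978.isogenyCharacter_add_div_eq_frobeniusTrace W p q hqp
      (hgood q hqp) hP0 hr hv h𝔓 hφ
    rw [← hmaz, hk' φ, Units.val_inv_eq_inv_val, Units.val_pow_eq_pow_val, hχ]
  -- polynomial form with `k mod (p − 1)`
  refine ⟨k % (p - 1), Nat.mod_lt _ (by have := hp.out.two_le; omega), fun q hq hqp => ?_⟩
  have hq0 : (q : ZMod p) ≠ 0 := by
    rw [Ne, ZMod.natCast_eq_zero_iff]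
    exact fun hd => hqp ((Nat.prime_dvd_prime_iff_eq hp.out hq.out).mp hd).symm
  have h1 := natCast_pow_sub_one_eq_one (p := p) hq.out hqp
  have he : k * (p - 2) % (p - 1) = (p - 2) * (k % (p - 1)) % (p - 1) := by
    rw [Nat.mul_mod, Nat.mul_comm (k % (p - 1)), Nat.mul_mod ((p - 2)), Nat.mod_mod]
  rw [key q hqp, inv_eq_pow_sub_two (pow_ne_zero k hq0), ← pow_mul, ← pow_eq_pow_mod k h1,
    pow_eq_pow_mod (k * (p - 2)) h1, he]

/-! ## §1 `A(11) = 121b1 = cm11`: `a_ℓ ≡ ℓ³ + ℓ⁸ (mod 11)` -/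

/-- `A(11) = cm11` has good reduction at every prime `ℓ ≠ 11` (`Δ_min = −11³`). [cite: Cremona1997, Table 1 (121b1)] -/
theorem hasGoodReductionAtPrime_cm11 (ℓ : ℕ) [hℓ : Fact ℓ.Prime] (h : ℓ ≠ 11) :
    cm11.HasGoodReductionAtPrime ℓ := by
  haveI : cm11.IsGloballyMinimal := P2.OddHeegnerTwists.isGloballyMinimal_cm11
  have hI : integralModelInt cm11 = ⟨0, -1, 1, -7, 10⟩ := P2.OddHeegnerTwists.integralModelInt_cm11
  have hmin : minimalDiscriminantInt cm11 = -((11 : ℕ) : ℤ) ^ 3 := by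
    rw [Summit.BirchSwinnertonDyer.BirchSwinnertonDyer.Rank1Residual.IntModel.minimalDiscriminantInt_eq hI]
    exact P2.OddHeegnerTwists.Δ_cm11_int
  refine hasGoodReductionAtPrime_of_not_dvd cm11 ℓ ?_
  rw [hmin, dvd_neg]
  intro hd
  have h' : (ℓ : ℤ) ∣ ((11 : ℕ) : ℤ) := (Nat.prime_iff_prime_int.mp hℓ.out).dvd_of_dvd_pow hd
  have h'' : ℓ ∣ 11 := by exact_mod_cast h'
  exact h ((Nat.prime_dvd_prime_iff_eq hℓ.out (by norm_num)).mp h'')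

/-- `a₂(A(11)) = 0`: the reduction of `[0, −1, 1, −7, 10]` mod `2` is `y² + y = x³ + x² + x`, with `#Ẽ(𝔽₂) = 3` (kernel point
count; `2` is inert in `ℚ(√−11)`). [cite: Cremona1997, Table 1 (121b1)] -/
theorem frobeniusTrace_cm11_two :
    (haveI := P2.OddHeegnerTwists.isGloballyMinimal_cm11; cm11.frobeniusTrace 2) = 0 := by
  haveI : cm11.IsGloballyMinimal := P2.OddHeegnerTwists.isGloballyMinimal_cm11
  have hI : integralModelInt cm11 = ⟨0, -1, 1, -7, 10⟩ := P2.OddHeegnerTwists.integralModelInt_cm11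
  have hcnt : Nat.card (((⟨0, -1, 1, -7, 10⟩ : WeierstrassCurve ℤ).map
      (Int.castRingHom (ZMod 2))).toAffine.Point) = 3 := by
    rw [@natCard_point_eq_one_add_card (ZMod 2) (@ZMod.instField 2 ⟨by norm_num⟩) _ _ _
      (by decide +kernel)]
    decide +kernel
  rw [Summit.BirchSwinnertonDyer.BirchSwinnertonDyer.Rank1Residual.IntModel.frobeniusTrace_eq hI hcnt]
  norm_num

/-- The finite check pinning the exponent at `p = 11`: `2ᵐ + 2·2^{9m mod 10} = 0` in `𝔽₁₁` with `m < 10` forces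
`m ∈ {3, 8}` (`2` is a primitive root mod `11`). [folklore] -/
theorem pin_cases_11 :
    ∀ m : ℕ, m < 10 → (2 : ZMod 11) ^ m + 2 * (2 : ZMod 11) ^ (9 * m % 10) = 0 → m = 3 ∨ m = 8 := by
  decide +kernel

/-- **`a_ℓ(A(11)) ≡ ℓ³ + ℓ⁸ (mod 11)` for every prime `ℓ ≠ 11`** (`ρ̄_{A(11),11}^{ss} = ω³ ⊕ ω⁸`; Gross LNM 776 Thm. 13.1.2,
Buhler–Gross 1985 (4.3) with `k = (3·11−1)/4 = 8`), PROVED: §0 with `A(11)[11]` reducible (CM by `ℚ(√−11)`, `11 ∣ d_K`;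
`X12.not_irr_of_hasCM_of_dvd_cmFieldDiscrOfJ`) and `a₂ = 0` pinning `k`.
[cite: Mazur1978, Prop. 6.3 (1) (p. 153)] [cite: BuhlerGross1985, Ch. I (4.3) (p. 14)] -/
theorem lFunction_cm11_mod (ℓ : ℕ) [hℓ : Fact ℓ.Prime] (h11 : ℓ ≠ 11) :
    (cm11.LFunction ℓ : ZMod 11) = (ℓ : ZMod 11) ^ 3 + (ℓ : ZMod 11) ^ 8 := by
  haveI : Fact (Nat.Prime 11) := ⟨by norm_num⟩
  haveI : cm11.IsGloballyMinimal := P2.OddHeegnerTwists.isGloballyMinimal_cm11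
  have hCM : cm11.HasCM := AnchorReduction.hasCM_of_j_eq cm11 (Or.inr (Or.inr (Or.inl rfl))) j_cm11
  have hred : ¬ cm11.HasIrreducibleModPGaloisRep 11 :=
    X12.not_irr_of_hasCM_of_dvd_cmFieldDiscrOfJ cm11 hCM 11 (by norm_num) (by rw [j_cm11]; norm_num [cmFieldDiscrOfJ])
  obtain ⟨k, hk, key⟩ := exists_frobeniusTrace_mod_eq_pow_add cm11 11 hred hasGoodReductionAtPrime_cm11
  haveI : Fact (Nat.Prime 2) := ⟨Nat.prime_two⟩
  have h₂ := key 2 (by norm_num)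
  rw [frobeniusTrace_cm11_two] at h₂
  push_cast at h₂
  have hk' : k = 3 ∨ k = 8 := pin_cases_11 k hk h₂.symm
  rw [LFunction_apply_prime_eq_frobeniusTrace cm11 ℓ (hasGoodReductionAtPrime_cm11 ℓ h11), key ℓ h11]
  rcases hk' with h | h <;> rw [h] <;> norm_num <;> ring

/-! ## §2 `A(19) = 361a1 = cm19`: `a_ℓ ≡ ℓ⁵ + ℓ¹⁴ (mod 19)` -/

/-- `A(19) = cm19` has good reduction at every prime `ℓ ≠ 19` (`Δ_min = −19³`). [cite: Cremona1997, Table 1 (361a1)] -/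
theorem hasGoodReductionAtPrime_cm19 (ℓ : ℕ) [hℓ : Fact ℓ.Prime] (h : ℓ ≠ 19) :
    cm19.HasGoodReductionAtPrime ℓ := by
  haveI : cm19.IsGloballyMinimal := P2.OddHeegnerTwists.isGloballyMinimal_cm19
  have hI : integralModelInt cm19 = ⟨0, 0, 1, -38, 90⟩ := P2.OddHeegnerTwists.integralModelInt_cm19
  have hmin : minimalDiscriminantInt cm19 = -((19 : ℕ) : ℤ) ^ 3 := by
    rw [Summit.BirchSwinnertonDyer.BirchSwinnertonDyer.Rank1Residual.IntModel.minimalDiscriminantInt_eq hI]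
    exact P2.OddHeegnerTwists.Δ_cm19_int
  refine hasGoodReductionAtPrime_of_not_dvd cm19 ℓ ?_
  rw [hmin, dvd_neg]
  intro hd
  have h' : (ℓ : ℤ) ∣ ((19 : ℕ) : ℤ) := (Nat.prime_iff_prime_int.mp hℓ.out).dvd_of_dvd_pow hd
  have h'' : ℓ ∣ 19 := by exact_mod_cast h'
  exact h ((Nat.prime_dvd_prime_iff_eq hℓ.out (by norm_num)).mp h'')

/-- `a₂(A(19)) = 0`: the reduction of `[0, 0, 1, −38, 90]` mod `2` is `y² + y = x³`, `#Ẽ(𝔽₂) = 3` (kernel point count; `2` inert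
in `ℚ(√−19)`). [cite: Cremona1997, Table 1 (361a1)] -/
theorem frobeniusTrace_cm19_two :
    (haveI := P2.OddHeegnerTwists.isGloballyMinimal_cm19; cm19.frobeniusTrace 2) = 0 := by
  haveI : cm19.IsGloballyMinimal := P2.OddHeegnerTwists.isGloballyMinimal_cm19
  have hI : integralModelInt cm19 = ⟨0, 0, 1, -38, 90⟩ := P2.OddHeegnerTwists.integralModelInt_cm19
  have hcnt : Nat.card (((⟨0, 0, 1, -38, 90⟩ : WeierstrassCurve ℤ).map
      (Int.castRingHom (ZMod 2))).toAffine.Point) = 3 := by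
    rw [@natCard_point_eq_one_add_card (ZMod 2) (@ZMod.instField 2 ⟨by norm_num⟩) _ _ _
      (by decide +kernel)]
    decide +kernel
  rw [Summit.BirchSwinnertonDyer.BirchSwinnertonDyer.Rank1Residual.IntModel.frobeniusTrace_eq hI hcnt]
  norm_num

/-- Pin at `p = 19`: `2ᵐ + 2·2^{17m mod 18} = 0` in `𝔽₁₉` with `m < 18` forces `m ∈ {5, 14}` (`2` is a primitive root mod `19`).
[folklore] -/
theorem pin_cases_19 :
    ∀ m : ℕ, m < 18 → (2 : ZMod 19) ^ m + 2 * (2 : ZMod 19) ^ (17 * m % 18) = 0 → m = 5 ∨ m = 14 := by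
  decide +kernel

/-- **`a_ℓ(A(19)) ≡ ℓ⁵ + ℓ¹⁴ (mod 19)` for every prime `ℓ ≠ 19`** (`ρ̄_{A(19),19}^{ss} = ω⁵ ⊕ ω¹⁴`; Buhler–Gross (4.3) with
`k = (3·19−1)/4 = 14`), PROVED as in §1. [cite: Mazur1978, Prop. 6.3 (1) (p. 153)] [cite: BuhlerGross1985, Ch. I (4.3) (p. 14)] -/
theorem lFunction_cm19_mod (ℓ : ℕ) [hℓ : Fact ℓ.Prime] (h19 : ℓ ≠ 19) :
    (cm19.LFunction ℓ : ZMod 19) = (ℓ : ZMod 19) ^ 5 + (ℓ : ZMod 19) ^ 14 := by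
  haveI : Fact (Nat.Prime 19) := ⟨by norm_num⟩
  haveI : cm19.IsGloballyMinimal := P2.OddHeegnerTwists.isGloballyMinimal_cm19
  have hCM : cm19.HasCM := AnchorReduction.hasCM_of_j_eq cm19 (Or.inr (Or.inr (Or.inr (Or.inl rfl)))) j_cm19
  have hred : ¬ cm19.HasIrreducibleModPGaloisRep 19 :=
    X12.not_irr_of_hasCM_of_dvd_cmFieldDiscrOfJ cm19 hCM 19 (by norm_num) (by rw [j_cm19]; norm_num [cmFieldDiscrOfJ])
  obtain ⟨k, hk, key⟩ := exists_frobeniusTrace_mod_eq_pow_add cm19 19 hred hasGoodReductionAtPrime_cm19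
  haveI : Fact (Nat.Prime 2) := ⟨Nat.prime_two⟩
  have h₂ := key 2 (by norm_num)
  rw [frobeniusTrace_cm19_two] at h₂
  push_cast at h₂
  have hk' : k = 5 ∨ k = 14 := pin_cases_19 k hk h₂.symm
  rw [LFunction_apply_prime_eq_frobeniusTrace cm19 ℓ (hasGoodReductionAtPrime_cm19 ℓ h19), key ℓ h19]
  rcases hk' with h | h <;> rw [h] <;> norm_num <;> ring

/-! ## §3 `A(43) = 1849a1 = cm43`: `a_ℓ ≡ ℓ¹¹ + ℓ³² (mod 43)` -/

/-- `A(43) = cm43` has good reduction at every prime `ℓ ≠ 43` (`Δ_min = −43³`). [cite: Cremona1997, Table 1 (1849a1)] -/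
theorem hasGoodReductionAtPrime_cm43 (ℓ : ℕ) [hℓ : Fact ℓ.Prime] (h : ℓ ≠ 43) :
    cm43.HasGoodReductionAtPrime ℓ := by
  haveI : cm43.IsGloballyMinimal := P2.OddHeegnerTwists.isGloballyMinimal_cm43
  have hI : integralModelInt cm43 = ⟨0, 0, 1, -860, 9707⟩ := P2.OddHeegnerTwists.integralModelInt_cm43
  have hmin : minimalDiscriminantInt cm43 = -((43 : ℕ) : ℤ) ^ 3 := by
    rw [Summit.BirchSwinnertonDyer.BirchSwinnertonDyer.Rank1Residual.IntModel.minimalDiscriminantInt_eq hI]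
    exact P2.OddHeegnerTwists.Δ_cm43_int
  refine hasGoodReductionAtPrime_of_not_dvd cm43 ℓ ?_
  rw [hmin, dvd_neg]
  intro hd
  have h' : (ℓ : ℤ) ∣ ((43 : ℕ) : ℤ) := (Nat.prime_iff_prime_int.mp hℓ.out).dvd_of_dvd_pow hd
  have h'' : ℓ ∣ 43 := by exact_mod_cast h'
  exact h ((Nat.prime_dvd_prime_iff_eq hℓ.out (by norm_num)).mp h'')

/-- `a₃(A(43)) = 0`: the reduction of `[0, 0, 1, −860, 9707]` mod `3` is `y² + y = x³ + x + 2`, `#Ẽ(𝔽₃) = 4` (kernel point count;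
`3` is inert in `ℚ(√−43)` and a primitive root mod `43`, whereas `2` has order `14`). [cite: Cremona1997, Table 1 (1849a1)] -/
theorem frobeniusTrace_cm43_three :
    (haveI := P2.OddHeegnerTwists.isGloballyMinimal_cm43; cm43.frobeniusTrace 3) = 0 := by
  haveI : cm43.IsGloballyMinimal := P2.OddHeegnerTwists.isGloballyMinimal_cm43
  have hI : integralModelInt cm43 = ⟨0, 0, 1, -860, 9707⟩ := P2.OddHeegnerTwists.integralModelInt_cm43
  have hcnt : Nat.card (((⟨0, 0, 1, -860, 9707⟩ : WeierstrassCurve ℤ).map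
      (Int.castRingHom (ZMod 3))).toAffine.Point) = 4 := by
    rw [@natCard_point_eq_one_add_card (ZMod 3) (@ZMod.instField 3 ⟨by norm_num⟩) _ _ _
      (by decide +kernel)]
    decide +kernel
  rw [Summit.BirchSwinnertonDyer.BirchSwinnertonDyer.Rank1Residual.IntModel.frobeniusTrace_eq hI hcnt]
  norm_num

/-- Pin at `p = 43`: `3ᵐ + 3·3^{41m mod 42} = 0` in `𝔽₄₃` with `m < 42` forces `m ∈ {11, 32}` (`3` is a primitive root mod `43`).
[folklore] -/
theorem pin_cases_43 :
    ∀ m : ℕ, m < 42 → (3 : ZMod 43) ^ m + 3 * (3 : ZMod 43) ^ (41 * m % 42) = 0 → m = 11 ∨ m = 32 := by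
  decide +kernel

/-- **`a_ℓ(A(43)) ≡ ℓ¹¹ + ℓ³² (mod 43)` for every prime `ℓ ≠ 43`** (`ρ̄_{A(43),43}^{ss} = ω¹¹ ⊕ ω³²`; Buhler–Gross (4.3) with
`k = (3·43−1)/4 = 32`), PROVED as in §1 with the pin at `q = 3`. [cite: Mazur1978, Prop. 6.3 (1) (p. 153)]
[cite: BuhlerGross1985, Ch. I (4.3) (p. 14)] -/
theorem lFunction_cm43_mod (ℓ : ℕ) [hℓ : Fact ℓ.Prime] (h43 : ℓ ≠ 43) :
    (cm43.LFunction ℓ : ZMod 43) = (ℓ : ZMod 43) ^ 11 + (ℓ : ZMod 43) ^ 32 := by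
  haveI : Fact (Nat.Prime 43) := ⟨by norm_num⟩
  haveI : cm43.IsGloballyMinimal := P2.OddHeegnerTwists.isGloballyMinimal_cm43
  have hCM : cm43.HasCM :=
    AnchorReduction.hasCM_of_j_eq cm43 (Or.inr (Or.inr (Or.inr (Or.inr (Or.inl rfl))))) j_cm43
  have hred : ¬ cm43.HasIrreducibleModPGaloisRep 43 :=
    X12.not_irr_of_hasCM_of_dvd_cmFieldDiscrOfJ cm43 hCM 43 (by norm_num) (by rw [j_cm43]; norm_num [cmFieldDiscrOfJ])
  obtain ⟨k, hk, key⟩ := exists_frobeniusTrace_mod_eq_pow_add cm43 43 hred hasGoodReductionAtPrime_cm43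
  haveI : Fact (Nat.Prime 3) := ⟨Nat.prime_three⟩
  have h₃ := key 3 (by norm_num)
  rw [frobeniusTrace_cm43_three] at h₃
  push_cast at h₃
  have hk' : k = 11 ∨ k = 32 := pin_cases_43 k hk h₃.symm
  rw [LFunction_apply_prime_eq_frobeniusTrace cm43 ℓ (hasGoodReductionAtPrime_cm43 ℓ h43), key ℓ h43]
  rcases hk' with h | h <;> rw [h] <;> norm_num <;> ring

/-! ## §4 `A(67) = 4489a1 = cm67`: `a_ℓ ≡ ℓ¹⁷ + ℓ⁵⁰ (mod 67)` -/

/-- `A(67) = cm67` has good reduction at every prime `ℓ ≠ 67` (`Δ_min = −67³`). [cite: Cremona1997, Table 1 (4489a1)] -/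
theorem hasGoodReductionAtPrime_cm67 (ℓ : ℕ) [hℓ : Fact ℓ.Prime] (h : ℓ ≠ 67) :
    cm67.HasGoodReductionAtPrime ℓ := by
  haveI : cm67.IsGloballyMinimal := P2.OddHeegnerTwists.isGloballyMinimal_cm67
  have hI : integralModelInt cm67 = ⟨0, 0, 1, -7370, 243528⟩ := P2.OddHeegnerTwists.integralModelInt_cm67
  have hmin : minimalDiscriminantInt cm67 = -((67 : ℕ) : ℤ) ^ 3 := by
    rw [Summit.BirchSwinnertonDyer.BirchSwinnertonDyer.Rank1Residual.IntModel.minimalDiscriminantInt_eq hI]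
    exact P2.OddHeegnerTwists.Δ_cm67_int
  refine hasGoodReductionAtPrime_of_not_dvd cm67 ℓ ?_
  rw [hmin, dvd_neg]
  intro hd
  have h' : (ℓ : ℤ) ∣ ((67 : ℕ) : ℤ) := (Nat.prime_iff_prime_int.mp hℓ.out).dvd_of_dvd_pow hd
  have h'' : ℓ ∣ 67 := by exact_mod_cast h'
  exact h ((Nat.prime_dvd_prime_iff_eq hℓ.out (by norm_num)).mp h'')

/-- `a₂(A(67)) = 0`: the reduction of `[0, 0, 1, −7370, 243528]` mod `2` is `y² + y = x³`, `#Ẽ(𝔽₂) = 3` (kernel point count;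
`2` inert in `ℚ(√−67)`). [cite: Cremona1997, Table 1 (4489a1)] -/
theorem frobeniusTrace_cm67_two :
    (haveI := P2.OddHeegnerTwists.isGloballyMinimal_cm67; cm67.frobeniusTrace 2) = 0 := by
  haveI : cm67.IsGloballyMinimal := P2.OddHeegnerTwists.isGloballyMinimal_cm67
  have hI : integralModelInt cm67 = ⟨0, 0, 1, -7370, 243528⟩ := P2.OddHeegnerTwists.integralModelInt_cm67
  have hcnt : Nat.card (((⟨0, 0, 1, -7370, 243528⟩ : WeierstrassCurve ℤ).map
      (Int.castRingHom (ZMod 2))).toAffine.Point) = 3 := by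
    rw [@natCard_point_eq_one_add_card (ZMod 2) (@ZMod.instField 2 ⟨by norm_num⟩) _ _ _
      (by decide +kernel)]
    decide +kernel
  rw [Summit.BirchSwinnertonDyer.BirchSwinnertonDyer.Rank1Residual.IntModel.frobeniusTrace_eq hI hcnt]
  norm_num

/-- Pin at `p = 67`: `2ᵐ + 2·2^{65m mod 66} = 0` in `𝔽₆₇` with `m < 66` forces `m ∈ {17, 50}` (`2` is a primitive root mod `67`).
[folklore] -/
theorem pin_cases_67 :
    ∀ m : ℕ, m < 66 → (2 : ZMod 67) ^ m + 2 * (2 : ZMod 67) ^ (65 * m % 66) = 0 → m = 17 ∨ m = 50 := by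
  decide +kernel

/-- **`a_ℓ(A(67)) ≡ ℓ¹⁷ + ℓ⁵⁰ (mod 67)` for every prime `ℓ ≠ 67`** (`ρ̄_{A(67),67}^{ss} = ω¹⁷ ⊕ ω⁵⁰`; Buhler–Gross (4.3) with
`k = (3·67−1)/4 = 50`), PROVED as in §1. [cite: Mazur1978, Prop. 6.3 (1) (p. 153)] [cite: BuhlerGross1985, Ch. I (4.3) (p. 14)] -/
theorem lFunction_cm67_mod (ℓ : ℕ) [hℓ : Fact ℓ.Prime] (h67 : ℓ ≠ 67) :
    (cm67.LFunction ℓ : ZMod 67) = (ℓ : ZMod 67) ^ 17 + (ℓ : ZMod 67) ^ 50 := by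
  haveI : Fact (Nat.Prime 67) := ⟨by norm_num⟩
  haveI : cm67.IsGloballyMinimal := P2.OddHeegnerTwists.isGloballyMinimal_cm67
  have hCM : cm67.HasCM :=
    AnchorReduction.hasCM_of_j_eq cm67 (Or.inr (Or.inr (Or.inr (Or.inr (Or.inr (Or.inl rfl)))))) j_cm67
  have hred : ¬ cm67.HasIrreducibleModPGaloisRep 67 :=
    X12.not_irr_of_hasCM_of_dvd_cmFieldDiscrOfJ cm67 hCM 67 (by norm_num) (by rw [j_cm67]; norm_num [cmFieldDiscrOfJ])
  obtain ⟨k, hk, key⟩ := exists_frobeniusTrace_mod_eq_pow_add cm67 67 hred hasGoodReductionAtPrime_cm67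
  haveI : Fact (Nat.Prime 2) := ⟨Nat.prime_two⟩
  have h₂ := key 2 (by norm_num)
  rw [frobeniusTrace_cm67_two] at h₂
  push_cast at h₂
  have hk' : k = 17 ∨ k = 50 := pin_cases_67 k hk h₂.symm
  rw [LFunction_apply_prime_eq_frobeniusTrace cm67 ℓ (hasGoodReductionAtPrime_cm67 ℓ h67), key ℓ h67]
  rcases hk' with h | h <;> rw [h] <;> norm_num <;> ring

end Summit.BirchSwinnertonDyer.BirchSwinnertonDyer.Theorems.PrintCFram.EisensteinTraceForm

end
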